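import Mathlib
import HarnessLib
import Summits.NavierStokesRegularity.NavierStokesRegularity.Theorems.TaylorModelRungThreeCertificateFormat

/-!
# Crux K1b-DR (stmt-NavierStokesRegularity-23954), line `taylor-model` — certificate SOUNDNESS, part 1: the BRIDGE
# between the list-coded checker arithmetic and `Finset` sums / the `CertData` interpretation

Helper lemmas for the soundness theorems of the certificate checker of
`Theorems/TaylorModelRungThreeCertificateFormat.lean` (CERT-CONTRACT-23954 v1, §3–§4):

* list coding ↔ big operators: `sumN n f = ∑ c ∈ range n, f c`, `allN`, entries of `mulVecN`, `mulMatN`,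
  `addVecN`, `addMatN`, `smulMatN`, `idMat`, `basisVec`, vectors built by `List.range n |>.map`;
* window coordinates: the coordinate `c = i·m + (k + Kb)` of `(i, k)` (`CertTables.idx`) and its inverse
  (`CertTables.wi`, `CertTables.wk`), the reindexing `∑_{i' : Fin 4} ∑_{kk < m} = ∑_{c < n}`;
* evaluation of the interpretation maps `vecR`, `linR`, `covR` of the format file through the window values
  `CertTables.wv T y c = y (wi c) (wk c)` of a shell state, the weights `(toCertData φ T).ω` on the window, and the
  translation of `InBall` / box hypotheses into coordinate-wise statements;

Pure bookkeeping; generic over an exact ordered field `K`. MODEL-lattice rung TL-M3 only; nothing here is a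
statement about the Navier–Stokes equations.
-/

-- the sub-problem namespace repeats the summit name by design (D-0017)
set_option linter.dupNamespace false

namespace Summit.NavierStokesRegularity.NavierStokesRegularity.Theorems.TaylorModelCert

open scoped BigOperators
open Literature.Analysis.FluidPDE.TaoCascade Literature.Analysis.FluidPDE.TaoCascade.TaylorChain

/-! ### List coding ↔ big operators -/

section ListOps

variable {K : Type} [Field K]

/-- `foldr` with an additive initial value. [folklore] -/
theorem foldr_add_init (l : List ℕ) (f : ℕ → K) (a : K) :
    l.foldr (fun c acc => f c + acc) a = l.foldr (fun c acc => f c + acc) 0 + a := by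
  induction l with
  | nil => simp
  | cons c l ih => simp only [List.foldr_cons]; rw [ih, add_assoc]

/-- `sumN` is the `Finset.range` sum. [folklore] -/
theorem sumN_eq (n : ℕ) (f : ℕ → K) : sumN n f = ∑ c ∈ Finset.range n, f c := by
  induction n with
  | zero => rfl
  | succ n ih =>
    unfold sumN at ih ⊢
    rw [List.range_succ, List.foldr_append, Finset.sum_range_succ, List.foldr_cons, List.foldr_nil,
      foldr_add_init, ih, add_zero]

/-- `dotN` is the `Finset.range` sum of products. [folklore] -/
theorem dotN_eq (n : ℕ) (u v : ℕ → K) : dotN n u v = ∑ c ∈ Finset.range n, u c * v c :=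
  sumN_eq n fun c => u c * v c

/-- `allN n p` means `p c` for all `c < n`. [folklore] -/
theorem allN_eq_true {n : ℕ} {p : ℕ → Bool} : allN n p = true ↔ ∀ c < n, p c = true := by
  simp [allN, List.all_eq_true, List.mem_range]

/-- Entries of a vector built over `List.range n`. [folklore] -/
theorem vget_map_range {L : Type} [Field L] {n c : ℕ} (g : ℕ → L) (hc : c < n) :
    vget ((List.range n).map g) c = g c := by
  simp [vget, List.getD_eq_getElem?_getD, List.getElem?_map, List.getElem?_range hc]

/-- Rows of a matrix built over `List.range n`. [folklore] -/
theorem getD_map_range {β : Type} {n r : ℕ} (g : ℕ → β) (d : β) (hr : r < n) :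
    ((List.range n).map g).getD r d = g r := by
  simp [List.getD_eq_getElem?_getD, List.getElem?_map, List.getElem?_range hr]

/-- Entries of a matrix built over `List.range n × List.range n'`. [folklore] -/
theorem mget_map_range {n n' r c : ℕ} (g : ℕ → ℕ → K) (hr : r < n) (hc : c < n') :
    mget ((List.range n).map fun r => (List.range n').map fun c => g r c) r c = g r c := by
  unfold mget
  rw [getD_map_range _ _ hr]
  exact vget_map_range (g r) hc

/-- Entries of `mulVecN`. [folklore] -/
theorem vget_mulVecN {n r : ℕ} (A : List (List K)) (v : List K) (hr : r < n) :
    vget (mulVecN n A v) r = ∑ c ∈ Finset.range n, mget A r c * vget v c := by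
  unfold mulVecN
  rw [vget_map_range _ hr, dotN_eq]

/-- Entries of `mulMatN`. [folklore] -/
theorem mget_mulMatN {n r c : ℕ} (A B : List (List K)) (hr : r < n) (hc : c < n) :
    mget (mulMatN n A B) r c = ∑ t ∈ Finset.range n, mget A r t * mget B t c := by
  unfold mulMatN
  rw [mget_map_range _ hr hc, dotN_eq]

/-- Entries of `addVecN`. [folklore] -/
theorem vget_addVecN {n c : ℕ} (u v : List K) (hc : c < n) :
    vget (addVecN n u v) c = vget u c + vget v c := by
  unfold addVecN
  rw [vget_map_range _ hc]

/-- Entries of `addMatN`. [folklore] -/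
theorem mget_addMatN {n r c : ℕ} (A B : List (List K)) (hr : r < n) (hc : c < n) :
    mget (addMatN n A B) r c = mget A r c + mget B r c := by
  unfold addMatN
  rw [mget_map_range _ hr hc]

/-- Entries of `smulMatN`. [folklore] -/
theorem mget_smulMatN {n r c : ℕ} (a : K) (A : List (List K)) (hr : r < n) (hc : c < n) :
    mget (smulMatN n a A) r c = a * mget A r c := by
  unfold smulMatN
  rw [mget_map_range _ hr hc]

/-- Entries of the zero vector over `List.range n`. [folklore] -/
theorem vget_zeroVec {n c : ℕ} (hc : c < n) : vget ((List.range n).map fun _ => (0 : K)) c = 0 :=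
  vget_map_range _ hc

/-- Entries of the zero matrix over `List.range n`. [folklore] -/
theorem mget_zeroMat {n r c : ℕ} (hr : r < n) (hc : c < n) :
    mget ((List.range n).map fun _ => (List.range n).map fun _ => (0 : K)) r c = 0 :=
  mget_map_range (fun _ _ => (0 : K)) hr hc

end ListOps

namespace CertTables

section Tables

variable {K : Type} [Field K]

/-- Entries of the identity matrix. [folklore] -/
theorem mget_idMat (T : CertTables K) {r c : ℕ} (hr : r < T.n) (hc : c < T.n) :
    mget T.idMat r c = if r = c then 1 else 0 := by
  unfold idMat
  rw [mget_map_range _ hr hc]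

/-- Entries of a coordinate vector. [folklore] -/
theorem vget_basisVec (T : CertTables K) {c c' : ℕ} (hc' : c' < T.n) :
    vget (T.basisVec c) c' = if c' = c then 1 else 0 := by
  unfold basisVec
  rw [vget_map_range _ hc']

end Tables

section Checks

variable {K : Type} [Field K] [LinearOrder K]

/-- `vecEq` means equality of the first `n` entries. [folklore] -/
theorem vecEq_eq_true (T : CertTables K) {u v : List K} :
    T.vecEq u v = true ↔ ∀ c < T.n, vget u c = vget v c := by
  simp [vecEq, allN_eq_true]

/-- `matEq` means equality on `n × n`. [folklore] -/
theorem matEq_eq_true (T : CertTables K) {A B : List (List K)} :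
    T.matEq A B = true ↔ ∀ r < T.n, ∀ c < T.n, mget A r c = mget B r c := by
  simp [matEq, allN_eq_true]

/-- `rowSumLe` means the weighted row-sum inequalities. [folklore] -/
theorem rowSumLe_eq_true (T : CertTables K) {A : List (List K)} {wIn bound : ℕ → K} :
    T.rowSumLe A wIn bound = true ↔ ∀ r < T.n, ∑ c ∈ Finset.range T.n, |mget A r c| * wIn c ≤ bound r := by
  simp [rowSumLe, allN_eq_true, sumN_eq]

end Checks

/-! ### Window coordinates -/

section Window

variable {K : Type}

/-- Mode index of window coordinate `c` (meaningful for `c < n`). [folklore] -/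
def wi (T : CertTables K) (c : ℕ) : Fin 4 := ⟨(c / T.m) % 4, Nat.mod_lt _ (by omega)⟩

/-- Shell of window coordinate `c` (meaningful for `c < n`). [folklore] -/
def wk (T : CertTables K) (c : ℕ) : ℤ := ((c % T.m : ℕ) : ℤ) - T.Kb

/-- Window values of a shell state, indexed by window coordinates. [folklore] -/
def wv (T : CertTables K) (y : Fin 4 → ℤ → ℝ) (c : ℕ) : ℝ := y (T.wi c) (T.wk c)

/-- If the window is inhabited, `m = Ka + Kb + 1`. [folklore] -/
theorem m_eq_of_InW (T : CertTables K) {k : ℤ} (hk : -T.Kb ≤ k ∧ k ≤ T.Ka) : (T.m : ℤ) = T.Ka + T.Kb + 1 := by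
  unfold m; omega

/-- A window shell index is `< m`. [folklore] -/
theorem toNat_shell_lt_m (T : CertTables K) {k : ℤ} (hk : -T.Kb ≤ k ∧ k ≤ T.Ka) : (k + T.Kb).toNat < T.m := by
  have := T.m_eq_of_InW hk; omega

/-- If the window is inhabited, `0 < m`. [folklore] -/
theorem m_pos_of_InW (T : CertTables K) {k : ℤ} (hk : -T.Kb ≤ k ∧ k ≤ T.Ka) : 0 < T.m := by
  have := T.toNat_shell_lt_m hk; omega

/-- The coordinate of a window index is `< n`. [folklore] -/
theorem idx_lt_n (T : CertTables K) (i : Fin 4) {k : ℤ} (hk : -T.Kb ≤ k ∧ k ≤ T.Ka) : T.idx i k < T.n := by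
  have h1 := T.toNat_shell_lt_m hk
  have hi := i.isLt
  unfold idx n
  nlinarith

/-- `idx i k / m = i`. [folklore] -/
theorem idx_div (T : CertTables K) (i : Fin 4) {k : ℤ} (hk : -T.Kb ≤ k ∧ k ≤ T.Ka) : T.idx i k / T.m = i.val := by
  have h1 := T.toNat_shell_lt_m hk
  have hm := T.m_pos_of_InW hk
  unfold idx
  rw [Nat.add_comm, Nat.add_mul_div_right _ _ hm, Nat.div_eq_of_lt h1, Nat.zero_add]

/-- `idx i k % m = k + Kb`. [folklore] -/
theorem idx_mod (T : CertTables K) (i : Fin 4) {k : ℤ} (hk : -T.Kb ≤ k ∧ k ≤ T.Ka) :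
    T.idx i k % T.m = (k + T.Kb).toNat := by
  have h1 := T.toNat_shell_lt_m hk
  unfold idx
  rw [Nat.add_comm, Nat.add_mul_mod_self_right, Nat.mod_eq_of_lt h1]

/-- `wi ∘ idx = id` on the window. [folklore] -/
theorem wi_idx (T : CertTables K) (i : Fin 4) {k : ℤ} (hk : -T.Kb ≤ k ∧ k ≤ T.Ka) : T.wi (T.idx i k) = i := by
  apply Fin.ext
  simp only [wi, T.idx_div i hk]
  exact Nat.mod_eq_of_lt i.isLt

/-- `wk ∘ idx = id` on the window. [folklore] -/
theorem wk_idx (T : CertTables K) (i : Fin 4) {k : ℤ} (hk : -T.Kb ≤ k ∧ k ≤ T.Ka) : T.wk (T.idx i k) = k := by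
  simp only [wk, T.idx_mod i hk]
  omega

/-- Every coordinate `c < n` is a window coordinate. [folklore] -/
theorem InW_wk (T : CertTables K) {c : ℕ} (hc : c < T.n) : (-T.Kb ≤ T.wk c ∧ T.wk c ≤ T.Ka) := by
  unfold n at hc
  have hm : 0 < T.m := by omega
  have h2 := Nat.mod_lt c hm
  unfold wk m at *
  omega

/-- `idx ∘ (wi, wk) = id` below `n`. [folklore] -/
theorem idx_wi_wk (T : CertTables K) {c : ℕ} (hc : c < T.n) : T.idx (T.wi c) (T.wk c) = c := by
  unfold n at hc
  have hm : 0 < T.m := by omega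
  have hdiv : c / T.m < 4 := by
    rw [Nat.div_lt_iff_lt_mul hm]; omega
  have hmod : ((((c % T.m : ℕ) : ℤ) - T.Kb) + T.Kb).toNat = c % T.m := by omega
  simp only [idx, wi, wk, Nat.mod_eq_of_lt hdiv, hmod]
  exact Nat.div_add_mod' c T.m

/-- Window values at a window coordinate. [folklore] -/
theorem wv_idx (T : CertTables K) (y : Fin 4 → ℤ → ℝ) (i : Fin 4) {k : ℤ} (hk : -T.Kb ≤ k ∧ k ≤ T.Ka) :
    T.wv y (T.idx i k) = y i k := by
  simp only [wv, T.wi_idx i hk, T.wk_idx i hk]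

/-- Reindexing `∑_{i' : Fin 4} ∑_{kk < m} f (i'·m + kk) = ∑_{c < n} f c`. [folklore] -/
theorem sum_window (T : CertTables K) (f : ℕ → ℝ) :
    ∑ i' : Fin 4, ∑ kk ∈ Finset.range T.m, f (i'.val * T.m + kk) = ∑ c ∈ Finset.range T.n, f c := by
  have hn : T.n = T.m + T.m + T.m + T.m := by unfold n; ring
  rw [hn, Finset.sum_range_add, Finset.sum_range_add, Finset.sum_range_add, Fin.sum_univ_four]
  simp only [Fin.val_zero, zero_mul, zero_add, Fin.val_one, one_mul, Fin.val_two]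
  have h3 : ((3 : Fin 4).val) = 3 := rfl
  simp only [h3]
  have e2 : ∀ kk, 2 * T.m + kk = T.m + T.m + kk := fun kk => by ring
  have e3 : ∀ kk, 3 * T.m + kk = T.m + T.m + T.m + kk := fun kk => by ring
  simp only [e2, e3]

/-- For `c = i'·m + kk` with `kk < m`: `wi c = i'`. [folklore] -/
theorem wi_of_pair (T : CertTables K) (i' : Fin 4) {kk : ℕ} (hkk : kk < T.m) : T.wi (i'.val * T.m + kk) = i' := by
  have hm : 0 < T.m := by omega
  apply Fin.ext
  simp only [wi]
  rw [Nat.add_comm, Nat.add_mul_div_right _ _ hm, Nat.div_eq_of_lt hkk, Nat.zero_add]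
  exact Nat.mod_eq_of_lt i'.isLt

/-- For `c = i'·m + kk` with `kk < m`: `wk c = kk - Kb`. [folklore] -/
theorem wk_of_pair (T : CertTables K) (i' : Fin 4) {kk : ℕ} (hkk : kk < T.m) :
    T.wk (i'.val * T.m + kk) = (kk : ℤ) - T.Kb := by
  simp only [wk]
  rw [Nat.add_comm, Nat.add_mul_mod_self_right, Nat.mod_eq_of_lt hkk]

/-- The double window sum of the interpretation maps as a single coordinate sum. [folklore] -/
theorem sum_window_wv (T : CertTables K) (g : ℕ → ℝ) (y : Fin 4 → ℤ → ℝ) :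
    ∑ i' : Fin 4, ∑ kk ∈ Finset.range T.m, g (i'.val * T.m + kk) * y i' ((kk : ℤ) - T.Kb) =
      ∑ c ∈ Finset.range T.n, g c * T.wv y c := by
  rw [← T.sum_window (fun c => g c * T.wv y c)]
  refine Finset.sum_congr rfl fun i' _ => Finset.sum_congr rfl fun kk hkk => ?_
  rw [Finset.mem_range] at hkk
  simp only [wv, T.wi_of_pair i' hkk, T.wk_of_pair i' hkk]

end Window

/-! ### Evaluation of the interpretation maps -/

section Interp

variable {K : Type} [Field K] (φ : K →+* ℝ) (T : CertTables K)

/-- `vecR` on and off the window. [folklore] -/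
theorem vecR_apply (v : List K) (i : Fin 4) (k : ℤ) :
    T.vecR φ v i k = if -T.Kb ≤ k ∧ k ≤ T.Ka then φ (vget v (T.idx i k)) else 0 := rfl

/-- Window values of `vecR`. [folklore] -/
theorem wv_vecR (v : List K) {c : ℕ} (hc : c < T.n) : T.wv (T.vecR φ v) c = φ (vget v c) := by
  unfold wv
  rw [vecR_apply, if_pos (T.InW_wk hc), T.idx_wi_wk hc]

/-- `vecR` is window-supported. [folklore] -/
theorem vecR_off (v : List K) (i : Fin 4) {k : ℤ} (hk : ¬ (-T.Kb ≤ k ∧ k ≤ T.Ka)) : T.vecR φ v i k = 0 := by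
  rw [vecR_apply, if_neg hk]

/-- `linR` on the window as a coordinate sum. [folklore] -/
theorem linR_apply_of_InW (A : List (List K)) (y : Fin 4 → ℤ → ℝ) (i : Fin 4) {k : ℤ} (hk : -T.Kb ≤ k ∧ k ≤ T.Ka) :
    T.linR φ A y i k = ∑ c ∈ Finset.range T.n, φ (mget A (T.idx i k) c) * T.wv y c := by
  unfold linR
  rw [if_pos hk]
  exact T.sum_window_wv (fun c => φ (mget A (T.idx i k) c)) y

/-- `linR` is window-supported. [folklore] -/
theorem linR_off (A : List (List K)) (y : Fin 4 → ℤ → ℝ) (i : Fin 4) {k : ℤ} (hk : ¬ (-T.Kb ≤ k ∧ k ≤ T.Ka)) :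
    T.linR φ A y i k = 0 := by
  unfold linR; rw [if_neg hk]

/-- Window values of `linR`. [folklore] -/
theorem wv_linR (A : List (List K)) (y : Fin 4 → ℤ → ℝ) {r : ℕ} (hr : r < T.n) :
    T.wv (T.linR φ A y) r = ∑ c ∈ Finset.range T.n, φ (mget A r c) * T.wv y c := by
  have h := T.linR_apply_of_InW φ A y (T.wi r) (T.InW_wk hr)
  rw [T.idx_wi_wk hr] at h
  simpa only [wv] using h

/-- `covR` as a coordinate sum. [folklore] -/
theorem covR_apply (w : List K) (y : Fin 4 → ℤ → ℝ) :
    T.covR φ w y = ∑ c ∈ Finset.range T.n, φ (vget w c) * T.wv y c := by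
  show ∑ i' : Fin 4, ∑ kk ∈ Finset.range T.m, φ (vget w (i'.val * T.m + kk)) * y i' ((kk : ℤ) - T.Kb) = _
  exact T.sum_window_wv (fun c => φ (vget w c)) y

omit [Field K] in
/-- Two window-supported states with the same window values are equal. [folklore] -/
theorem eq_of_wv_eq {y y' : Fin 4 → ℤ → ℝ} (hy : ∀ i k, ¬ (-T.Kb ≤ k ∧ k ≤ T.Ka) → y i k = 0)
    (hy' : ∀ i k, ¬ (-T.Kb ≤ k ∧ k ≤ T.Ka) → y' i k = 0) (h : ∀ c < T.n, T.wv y c = T.wv y' c) : y = y' := by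
  funext i k
  by_cases hk : -T.Kb ≤ k ∧ k ≤ T.Ka
  · have := h (T.idx i k) (T.idx_lt_n i hk)
    rwa [T.wv_idx y i hk, T.wv_idx y' i hk] at this
  · rw [hy i k hk, hy' i k hk]

omit [Field K] in
/-- A window statement `∀ i k, InW k → P (y i k) …` from its coordinate form. [folklore] -/
theorem forall_window_of_forall_coord {P : Fin 4 → ℤ → Prop} (h : ∀ c < T.n, P (T.wi c) (T.wk c)) :
    ∀ i k, (-T.Kb ≤ k ∧ k ≤ T.Ka) → P i k := by
  intro i k hk
  have := h (T.idx i k) (T.idx_lt_n i hk)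
  rwa [T.wi_idx i hk, T.wk_idx i hk] at this

omit [Field K] in
/-- … and conversely. [folklore] -/
theorem forall_coord_of_forall_window {P : Fin 4 → ℤ → Prop} (h : ∀ i k, (-T.Kb ≤ k ∧ k ≤ T.Ka) → P i k) :
    ∀ c < T.n, P (T.wi c) (T.wk c) := fun _ hc => h _ _ (T.InW_wk hc)

/-- The weights of `toCertData` at a window coordinate. [folklore] -/
theorem omega_wk (j : ℕ) {c : ℕ} (hc : c < T.n) : (T.toCertData φ).ω j (T.wk c) = φ (T.wgt j c) := by
  have hk := T.InW_wk hc
  show (if -T.Kb ≤ T.wk c ∧ T.wk c ≤ T.Ka then φ (vget (T.stage j).ω (T.wk c + T.Kb).toNat) else 1) = _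
  rw [if_pos hk]
  unfold wgt wk
  congr 2
  omega

/-- The weights of `toCertData` on the window, via `idx`. [folklore] -/
theorem omega_of_InW (j : ℕ) (i : Fin 4) {k : ℤ} (hk : -T.Kb ≤ k ∧ k ≤ T.Ka) :
    (T.toCertData φ).ω j k = φ (T.wgt j (T.idx i k)) := by
  have h := T.omega_wk φ j (T.idx_lt_n i hk)
  rwa [T.wk_idx i hk] at h

/-- `InBall` of `toCertData` in coordinates. [folklore] -/
theorem inBall_iff (j : ℕ) (y : Fin 4 → ℤ → ℝ) (N : ℝ) :
    (T.toCertData φ).InBall j y N ↔ ∀ c < T.n, |T.wv y c| ≤ N * φ (T.wgt j c) := by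
  constructor
  · intro h c hc
    have hk := T.InW_wk hc
    have := h (T.wi c) (T.wk c) hk.1 hk.2
    rwa [T.omega_wk φ j hc] at this
  · intro h i k hk1 hk2
    have hk : -T.Kb ≤ k ∧ k ≤ T.Ka := ⟨hk1, hk2⟩
    have := h (T.idx i k) (T.idx_lt_n i hk)
    rwa [T.wv_idx y i hk, ← T.omega_of_InW φ j i hk] at this

/-- A box hypothesis `|ξ i k| ≤ (vecR r) i k` on the window, in coordinates. [folklore] -/
theorem box_iff (r : List K) (ξ : Fin 4 → ℤ → ℝ) :
    (∀ i k, -T.Kb ≤ k → k ≤ T.Ka → |ξ i k| ≤ T.vecR φ r i k) ↔ ∀ c < T.n, |T.wv ξ c| ≤ φ (vget r c) := by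
  constructor
  · intro h c hc
    have hk := T.InW_wk hc
    have := h (T.wi c) (T.wk c) hk.1 hk.2
    rwa [vecR_apply, if_pos hk, T.idx_wi_wk hc] at this
  · intro h i k hk1 hk2
    have hk : -T.Kb ≤ k ∧ k ≤ T.Ka := ⟨hk1, hk2⟩
    have := h (T.idx i k) (T.idx_lt_n i hk)
    have e : T.vecR φ r i k = φ (vget r (T.idx i k)) := by rw [vecR_apply, if_pos hk]
    rwa [T.wv_idx ξ i hk, ← e] at this

/-- `Wsupp` of `toCertData` is window support. [folklore] -/
theorem wsupp_iff (y : Fin 4 → ℤ → ℝ) :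
    (T.toCertData φ).Wsupp y ↔ ∀ i k, ¬ (-T.Kb ≤ k ∧ k ≤ T.Ka) → y i k = 0 := Iff.rfl

end Interp

end CertTables

end Summit.NavierStokesRegularity.NavierStokesRegularity.Theorems.TaylorModelCert
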